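import Mathlib.Analysis.SpecialFunctions.Pow.Real
import Mathlib.Analysis.SpecialFunctions.Sqrt
import Literature.Probability.LatticeModels.ThermodynamicLimit
import HarnessLib

/-!
# Crux `PercShatteringRace.FreeSusceptibilityPowerSaving` (stmt-CriticalPhenomena-5786), line `two-ghost-at-distance-bootstrap` — stub `stub_bootstrapAnalysis`

Helper file for the line skeleton of the lead (prover-line-stmt-CriticalPhenomena-5786-1),
`--supports stmt-CriticalPhenomena-5786`; it proves exactly the registered stub
`stub_bootstrapAnalysis`: the ABSTRACT BOOTSTRAP behind Hutchcroft, *Power-law bounds for critical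
long-range percolation below the upper-critical dimension*, PTRF 181 (2021) = arXiv:2008.11197,
Lemma 4.1 and the proof of Thm 1.2 (pp. 19–20) — the optimisation of the radius `r` and the
contraction `A ↦ B A^{1/(1+θ)}` — for an abstract sequence `P : ℕ → [0, ∞)` (playing `P_p(|K_0| ≥ n)`),
an abstract "two-ghost" term `S(n,r)` and an abstract "susceptibility in the box" term `T(r)`
(`|Λ_r| = |box 3 r| = (2r+1)³`).  PURE REAL ANALYSIS; no probability.

Proof.  (1) `le_improve`: if `P(m') ≤ A m'^{-θ}` for all `m' ≥ 1` (`A ≥ 1`) then for `m ≥ 1`, with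
`r = ⌈m^s⌉`, `s = (1+θ)/3` (so `m^s ≤ r ≤ 2 m^s`, `|Λ_r| ≥ r³ ≥ m^{1+θ}`):
`P(m)² ≤ C₂ r^{x₂} m^{-y} + C₁ A^{2/(1+θ)} |Λ_r|^{-2θ/(1+θ)} ≤ C₂ 2^{x₂} m^{s x₂ - y} + C₁ A^{2/(1+θ)} m^{-2θ}`
and `s x₂ - y ≤ -2θ ⟺ θ(x₂ + 6) ≤ 3y - x₂`; hence `P(m) ≤ B A^{1/(1+θ)} m^{-θ}`, `B = √(C₂ 2^{x₂} + C₁)`.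
(2) `𝒜 = {A ≥ 1 : ∀ m ≥ 1, P(m) ≤ A m^{-θ}}` is nonempty (`max(1,χ)`, as `θ ≤ 1`) and `A* = inf 𝒜 ∈ 𝒜`.
(3) By (1), `B' A*^{1/(1+θ)} ∈ 𝒜` with `B' = max(1,B)`, so `A* ≤ B' A*^{1/(1+θ)}`, i.e.
`A*^{θ/(1+θ)} ≤ B'` (`rpow_bootstrap_le`), whence `A* ≤ K := B'^{(1+θ)/θ}` — a constant NOT depending
on `χ`.  The rpow bookkeeping is adapted from the in-tree long-range twin
`Literature/Probability/Percolation/LongRangeVolumeTailBootstrap.lean` (`volumeTail_of_twoGhost`).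
No definitions.
-/

noncomputable section

namespace Summit.CriticalPhenomena.PercolationContinuityZ3.Theorems

open Literature.Probability.LatticeModels

namespace StubBootstrapAnalysis

/-- The contraction step of the bootstrap: `1 ≤ A ≤ B A^{1/(1+θ)}` (`θ > 0`) forces
`A ≤ B^{(1+θ)/θ}` (so `B ≥ 1` automatically). [cite: Hutchcroft2021, proof of Thm. 1.2 (p. 20)] -/
theorem rpow_bootstrap_le {θ A B : ℝ} (hθ : 0 < θ) (hA : 1 ≤ A)
    (h : A ≤ B * A ^ (1 / (1 + θ))) : A ≤ B ^ ((1 + θ) / θ) := by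
  have hApos : 0 < A := by linarith
  have hθ1 : (1 + θ) ≠ 0 := by positivity
  have hsplit : A ^ (θ / (1 + θ)) * A ^ (1 / (1 + θ)) = A := by
    rw [← Real.rpow_add hApos, ← add_div, add_comm, div_self hθ1, Real.rpow_one]
  have hpow_pos : 0 < A ^ (1 / (1 + θ)) := Real.rpow_pos_of_pos hApos _
  have hle : A ^ (θ / (1 + θ)) ≤ B := by
    refine le_of_mul_le_mul_right ?_ hpow_pos
    calc A ^ (θ / (1 + θ)) * A ^ (1 / (1 + θ)) = A := hsplit
      _ ≤ B * A ^ (1 / (1 + θ)) := h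
  have h0 : 0 ≤ A ^ (θ / (1 + θ)) := Real.rpow_nonneg hApos.le _
  calc A = (A ^ (θ / (1 + θ))) ^ ((1 + θ) / θ) := by
        rw [← Real.rpow_mul hApos.le, div_mul_div_comm, mul_comm θ (1 + θ),
          div_self (mul_ne_zero hθ1 hθ.ne'), Real.rpow_one]
    _ ≤ B ^ ((1 + θ) / θ) := Real.rpow_le_rpow h0 hle (by positivity)

/-- **The optimisation of the radius (Hutchcroft 2021, Lemma 4.1 / proof of Thm 1.2, abstract form).**
If `P(m') ≤ A m'^{-θ}` feeds the hyperscaling bound `T(r) ≤ C₁ A^{2/(1+θ)} |Λ_r|^{(1-θ)/(1+θ)}`, the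
two-ghost bound reads `S(m,r) ≤ C₂ |Λ_r| r^{x₂} m^{-y}` and the one-step inequality
`P(m)² |Λ_r| ≤ S(m,r) + T(r)` holds for all `r ≥ 1`, then, provided `θ(x₂ + 6) ≤ 3y - x₂`,
`P(m) ≤ √(C₂ 2^{x₂} + C₁) · A^{1/(1+θ)} · m^{-θ}` (choose `r = ⌈m^{(1+θ)/3}⌉`).
[cite: Hutchcroft2021, Lemma 4.1 and proof of Thm. 1.2 (pp. 19–20)] -/
theorem le_improve {θ x₂ y C₁ C₂ A Pm : ℝ} {m : ℕ} (hθ : 0 < θ) (hx₂ : 0 ≤ x₂)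
    (hreg : θ * (x₂ + 6) ≤ 3 * y - x₂) (hC₁ : 0 ≤ C₁) (hC₂ : 0 ≤ C₂) (hA : 1 ≤ A) (hPm : 0 ≤ Pm)
    (hm : 1 ≤ m) (T Sm : ℕ → ℝ)
    (hstep : ∀ r : ℕ, 1 ≤ r → Pm ^ 2 * ((box 3 r).card : ℝ) ≤ Sm r + T r)
    (hT : ∀ r : ℕ, 1 ≤ r →
      T r ≤ C₁ * A ^ (2 / (1 + θ)) * ((box 3 r).card : ℝ) ^ ((1 - θ) / (1 + θ)))
    (hS : ∀ r : ℕ, 1 ≤ r → Sm r ≤ C₂ * ((box 3 r).card : ℝ) * (r : ℝ) ^ x₂ * (m : ℝ) ^ (-y)) :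
    Pm ≤ Real.sqrt (C₂ * 2 ^ x₂ + C₁) * A ^ (1 / (1 + θ)) * (m : ℝ) ^ (-θ) := by
  have hmpos : (0 : ℝ) < m := by exact_mod_cast hm
  have hm1 : (1 : ℝ) ≤ m := by exact_mod_cast hm
  have hθ1 : 0 < 1 + θ := by linarith
  have hA0 : 0 ≤ A := by linarith
  -- the radius `r = ⌈m^s⌉`, `s = (1+θ)/3`
  set s : ℝ := (1 + θ) / 3 with hs
  have hs0 : 0 ≤ s := div_nonneg hθ1.le (by norm_num)
  set ρ : ℝ := (m : ℝ) ^ s with hρ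
  have hρ1 : 1 ≤ ρ := Real.one_le_rpow hm1 hs0
  have hρpos : 0 < ρ := by linarith
  obtain ⟨r, hr1, hrge, hrle⟩ : ∃ r : ℕ, 1 ≤ r ∧ ρ ≤ r ∧ (r : ℝ) ≤ 2 * ρ := by
    refine ⟨⌈ρ⌉₊, Nat.one_le_iff_ne_zero.2 (Nat.pos_iff_ne_zero.1 (Nat.ceil_pos.2 hρpos)),
      Nat.le_ceil ρ, ?_⟩
    have := Nat.ceil_lt_add_one hρpos.le
    linarith
  have hrpos : (0 : ℝ) < r := by linarith
  -- the box `Λ_r`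
  set V : ℝ := ((box 3 r).card : ℝ) with hV
  have hVeq : V = (2 * (r : ℝ) + 1) ^ 3 := by rw [hV, card_box]; push_cast; ring
  have hVpos : 0 < V := by rw [hVeq]; positivity
  have hVge : (m : ℝ) ^ (1 + θ) ≤ V := by
    have e : (m : ℝ) ^ (1 + θ) = ρ ^ (3 : ℕ) := by
      rw [hρ, ← Real.rpow_natCast, ← Real.rpow_mul hmpos.le]
      congr 1
      rw [hs]; push_cast; ring
    rw [e, hVeq]
    exact pow_le_pow_left₀ hρpos.le (by linarith) 3
  -- (a) `Pm² ≤ C₂ r^{x₂} m^{-y} + C₁ A^{2/(1+θ)} V^{-2θ/(1+θ)}`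
  have hVsplit : V ^ ((1 - θ) / (1 + θ)) = V ^ (-(2 * θ / (1 + θ))) * V := by
    have : (1 - θ) / (1 + θ) = -(2 * θ / (1 + θ)) + 1 := by
      field_simp
      ring
    rw [this, Real.rpow_add_one hVpos.ne']
  have ha : Pm ^ 2 ≤ C₂ * (r : ℝ) ^ x₂ * (m : ℝ) ^ (-y) +
      C₁ * A ^ (2 / (1 + θ)) * V ^ (-(2 * θ / (1 + θ))) := by
    refine le_of_mul_le_mul_right ?_ hVpos
    calc Pm ^ 2 * V ≤ Sm r + T r := hstep r hr1
      _ ≤ C₂ * V * (r : ℝ) ^ x₂ * (m : ℝ) ^ (-y) +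
          C₁ * A ^ (2 / (1 + θ)) * V ^ ((1 - θ) / (1 + θ)) := add_le_add (hS r hr1) (hT r hr1)
      _ = _ := by rw [hVsplit]; ring
  -- (b) both terms are `≤ const · m^{-2θ}`
  have hb1 : (r : ℝ) ^ x₂ * (m : ℝ) ^ (-y) ≤ 2 ^ x₂ * (m : ℝ) ^ (-(2 * θ)) := by
    have h1 : (r : ℝ) ^ x₂ ≤ 2 ^ x₂ * (m : ℝ) ^ (s * x₂) := by
      calc (r : ℝ) ^ x₂ ≤ (2 * ρ) ^ x₂ := Real.rpow_le_rpow hrpos.le hrle hx₂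
        _ = 2 ^ x₂ * (m : ℝ) ^ (s * x₂) := by
            rw [Real.mul_rpow (by norm_num) hρpos.le, hρ, ← Real.rpow_mul hmpos.le]
    have h2 : (m : ℝ) ^ (s * x₂) * (m : ℝ) ^ (-y) ≤ (m : ℝ) ^ (-(2 * θ)) := by
      rw [← Real.rpow_add hmpos]
      apply Real.rpow_le_rpow_of_exponent_le hm1
      rw [hs]
      linarith
    calc (r : ℝ) ^ x₂ * (m : ℝ) ^ (-y) ≤ 2 ^ x₂ * (m : ℝ) ^ (s * x₂) * (m : ℝ) ^ (-y) :=
          mul_le_mul_of_nonneg_right h1 (by positivity)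
      _ = 2 ^ x₂ * ((m : ℝ) ^ (s * x₂) * (m : ℝ) ^ (-y)) := by ring
      _ ≤ 2 ^ x₂ * (m : ℝ) ^ (-(2 * θ)) := mul_le_mul_of_nonneg_left h2 (by positivity)
  have hb2 : V ^ (-(2 * θ / (1 + θ))) ≤ (m : ℝ) ^ (-(2 * θ)) := by
    have hexp : -(2 * θ / (1 + θ)) ≤ 0 := by
      have : 0 ≤ 2 * θ / (1 + θ) := by positivity
      linarith
    calc V ^ (-(2 * θ / (1 + θ))) ≤ ((m : ℝ) ^ (1 + θ)) ^ (-(2 * θ / (1 + θ))) :=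
          Real.rpow_le_rpow_of_nonpos (by positivity) hVge hexp
      _ = (m : ℝ) ^ (-(2 * θ)) := by
          rw [← Real.rpow_mul hmpos.le]
          congr 1
          field_simp
  -- (c) assemble: `Pm² ≤ (C₂ 2^{x₂} + C₁) A^{2/(1+θ)} m^{-2θ}`
  have hA2 : 1 ≤ A ^ (2 / (1 + θ)) := Real.one_le_rpow hA (by positivity)
  have hm2θ : 0 ≤ (m : ℝ) ^ (-(2 * θ)) := by positivity
  have h2x : 0 ≤ (2 : ℝ) ^ x₂ := by positivity
  have hsq : Pm ^ 2 ≤ (C₂ * 2 ^ x₂ + C₁) * A ^ (2 / (1 + θ)) * (m : ℝ) ^ (-(2 * θ)) := by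
    have h1 := mul_le_mul_of_nonneg_left hb1 hC₂
    have h2 := mul_le_mul_of_nonneg_left hb2 (mul_nonneg hC₁ (zero_le_one.trans hA2))
    have h3 := mul_le_mul_of_nonneg_left hA2 (mul_nonneg (mul_nonneg hC₂ h2x) hm2θ)
    linarith
  -- (d) square roots
  have eA : Real.sqrt (A ^ (2 / (1 + θ))) = A ^ (1 / (1 + θ)) := by
    rw [Real.sqrt_eq_rpow, ← Real.rpow_mul hA0]
    congr 1
    ring
  have em : Real.sqrt ((m : ℝ) ^ (-(2 * θ))) = (m : ℝ) ^ (-θ) := by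
    rw [Real.sqrt_eq_rpow, ← Real.rpow_mul hmpos.le]
    congr 1
    ring
  calc Pm = Real.sqrt (Pm ^ 2) := (Real.sqrt_sq hPm).symm
    _ ≤ Real.sqrt ((C₂ * 2 ^ x₂ + C₁) * A ^ (2 / (1 + θ)) * (m : ℝ) ^ (-(2 * θ))) :=
        Real.sqrt_le_sqrt hsq
    _ = Real.sqrt (C₂ * 2 ^ x₂ + C₁) * A ^ (1 / (1 + θ)) * (m : ℝ) ^ (-θ) := by
        rw [Real.sqrt_mul (by positivity), Real.sqrt_mul (by positivity), eA, em]

end StubBootstrapAnalysis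

open StubBootstrapAnalysis in
/-- **stub_bootstrapAnalysis (THE ABSTRACT BOOTSTRAP of Hutchcroft 2021, Lemma 4.1 + proof of Thm 1.2).**
For `0 < θ ≤ 1/2`, `x₂ ≥ 0`, `y` with `θ(x₂ + 6) ≤ 3y − x₂` and constants `C₁, C₂ ≥ 0` there is
`K = K(θ, x₂, y, C₁, C₂) ≥ 1` such that: whenever `P : ℕ → [0,1]`, `T : ℕ → ℝ`, `S : ℕ → ℕ → ℝ` satisfy
(a-priori) `P(n) ≤ χ/n` for some `χ` and all `n ≥ 1`; (one step) `P(n)² |Λ_r| ≤ S(n,r) + T(r)`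
(`n, r ≥ 1`); (hyperscaling) for every `A ≥ 1`, `[∀ n ≥ 1, P(n) ≤ A n^{−θ}] ⟹ ∀ r ≥ 1,
T(r) ≤ C₁ A^{2/(1+θ)} |Λ_r|^{(1−θ)/(1+θ)}`; (two-ghost) `S(n,r) ≤ C₂ |Λ_r| r^{x₂} n^{−y}` — then
`P(n) ≤ K n^{−θ}` for all `n ≥ 1`, with `K = max(1, √(C₂ 2^{x₂} + C₁))^{(1+θ)/θ}` NOT depending on `χ`
(`|Λ_r| = |box 3 r| = (2r+1)³`).  Proof: `𝒜 = {A ≥ 1 : ∀ n ≥ 1, P(n) ≤ A n^{−θ}} ∋ max(1, χ)`,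
`A* = inf 𝒜 ∈ 𝒜`, `le_improve` at `A*` gives `B' A*^{1/(1+θ)} ∈ 𝒜`, hence `A* ≤ B' A*^{1/(1+θ)}` and
`A* ≤ B'^{(1+θ)/θ}` (`rpow_bootstrap_le`).
[cite: Hutchcroft2021, Lemma 4.1 and proof of Thm. 1.2 (pp. 19–20)] -/
theorem stub_bootstrapAnalysis :
    ∀ (θ x₂ y C₁ C₂ : ℝ), 0 < θ → θ ≤ 1 / 2 → 0 ≤ x₂ → θ * (x₂ + 6) ≤ 3 * y - x₂ →
      0 ≤ C₁ → 0 ≤ C₂ →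
      ∃ K : ℝ, 1 ≤ K ∧ ∀ (P : ℕ → ℝ) (T : ℕ → ℝ) (S : ℕ → ℕ → ℝ),
        (∀ n, 0 ≤ P n) → (∀ n, P n ≤ 1) →
        (∃ χ : ℝ, ∀ n : ℕ, 1 ≤ n → P n ≤ χ / n) →
        (∀ n r : ℕ, 1 ≤ n → 1 ≤ r → P n ^ 2 * ((box 3 r).card : ℝ) ≤ S n r + T r) →
        (∀ A : ℝ, 1 ≤ A → (∀ n : ℕ, 1 ≤ n → P n ≤ A * (n : ℝ) ^ (-θ)) →
          ∀ r : ℕ, 1 ≤ r →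
            T r ≤ C₁ * A ^ (2 / (1 + θ)) * ((box 3 r).card : ℝ) ^ ((1 - θ) / (1 + θ))) →
        (∀ n r : ℕ, 1 ≤ n → 1 ≤ r →
          S n r ≤ C₂ * ((box 3 r).card : ℝ) * (r : ℝ) ^ x₂ * (n : ℝ) ^ (-y)) →
        ∀ n : ℕ, 1 ≤ n → P n ≤ K * (n : ℝ) ^ (-θ) := by
  intro θ x₂ y C₁ C₂ hθ hθ2 hx₂ hreg hC₁ hC₂
  -- the constants `B = √(C₂ 2^{x₂} + C₁)`, `B' = max 1 B`, `K = B'^{(1+θ)/θ}`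
  set B : ℝ := Real.sqrt (C₂ * 2 ^ x₂ + C₁) with hB
  set B' : ℝ := max 1 B with hB'
  have hB'1 : 1 ≤ B' := le_max_left _ _
  have hexp0 : 0 ≤ (1 + θ) / θ := by positivity
  refine ⟨B' ^ ((1 + θ) / θ), Real.one_le_rpow hB'1 hexp0, ?_⟩
  rintro P T S hP0 - ⟨χ, hχ⟩ hstep hT hS n hn
  -- Step 1: the set of admissible constants is nonempty and `A* = inf 𝒜` is a member
  set 𝒜 : Set ℝ := {A | 1 ≤ A ∧ ∀ m : ℕ, 1 ≤ m → P m ≤ A * (m : ℝ) ^ (-θ)} with h𝒜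
  have h𝒜ne : 𝒜.Nonempty := by
    refine ⟨max 1 χ, le_max_left _ _, fun m hm => ?_⟩
    have hmpos : (0 : ℝ) < m := by exact_mod_cast hm
    have hm1 : (1 : ℝ) ≤ m := by exact_mod_cast hm
    calc P m ≤ χ / m := hχ m hm
      _ ≤ max 1 χ / m := div_le_div_of_nonneg_right (le_max_right _ _) hmpos.le
      _ = max 1 χ * (m : ℝ) ^ (-(1 : ℝ)) := by rw [Real.rpow_neg_one, div_eq_mul_inv]
      _ ≤ max 1 χ * (m : ℝ) ^ (-θ) := by
          apply mul_le_mul_of_nonneg_left _ (zero_le_one.trans (le_max_left _ _))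
          exact Real.rpow_le_rpow_of_exponent_le hm1 (by linarith)
  have h𝒜bdd : BddBelow 𝒜 := ⟨1, fun A hA => hA.1⟩
  set Astar := sInf 𝒜 with hAstar
  have hAstar1 : 1 ≤ Astar := le_csInf h𝒜ne fun A hA => hA.1
  have hAstar_mem : ∀ m : ℕ, 1 ≤ m → P m ≤ Astar * (m : ℝ) ^ (-θ) := by
    intro m hm
    have hmpos : (0 : ℝ) < m := by exact_mod_cast hm
    have hpow : 0 < (m : ℝ) ^ (-θ) := Real.rpow_pos_of_pos hmpos _
    rw [← div_le_iff₀ hpow]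
    exact le_csInf h𝒜ne fun A hA => (div_le_iff₀ hpow).2 (hA.2 m hm)
  -- Step 2: the improvement at `A*` (optimisation of the radius)
  have himp : ∀ m : ℕ, 1 ≤ m → P m ≤ B * Astar ^ (1 / (1 + θ)) * (m : ℝ) ^ (-θ) := fun m hm =>
    le_improve hθ hx₂ hreg hC₁ hC₂ hAstar1 (hP0 m) hm T (S m) (fun r hr => hstep m r hm hr)
      (hT Astar hAstar1 hAstar_mem) (fun r hr => hS m r hm hr)
  -- Step 3: `B' A*^{1/(1+θ)} ∈ 𝒜`, hence `A* ≤ B' A*^{1/(1+θ)}` and `A* ≤ K`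
  have hf0 : 0 ≤ Astar ^ (1 / (1 + θ)) := Real.rpow_nonneg (zero_le_one.trans hAstar1) _
  have hf1 : 1 ≤ Astar ^ (1 / (1 + θ)) := Real.one_le_rpow hAstar1 (by positivity)
  have hmem : B' * Astar ^ (1 / (1 + θ)) ∈ 𝒜 := by
    refine ⟨one_le_mul_of_one_le_of_one_le hB'1 hf1, fun m hm => (himp m hm).trans ?_⟩
    exact mul_le_mul_of_nonneg_right (mul_le_mul_of_nonneg_right (le_max_right _ _) hf0)
      (by positivity)
  have hAle : Astar ≤ B' * Astar ^ (1 / (1 + θ)) := csInf_le h𝒜bdd hmem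
  have hAK : Astar ≤ B' ^ ((1 + θ) / θ) := rpow_bootstrap_le hθ hAstar1 hAle
  -- conclude
  calc P n ≤ Astar * (n : ℝ) ^ (-θ) := hAstar_mem n hn
    _ ≤ B' ^ ((1 + θ) / θ) * (n : ℝ) ^ (-θ) := mul_le_mul_of_nonneg_right hAK (by positivity)

end Summit.CriticalPhenomena.PercolationContinuityZ3.Theorems

end
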